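import Summits.AtomisticToContinuum.Crystallization.Theorems.ChartedZeroExcessLayeredLatticeLiouvilleYO

/-!
# Part YQ «FluxResponse» v2 (lens-2 g69): the a-priori leaf (X2ᴸ) from CLASS-SPLIT LINEAR RESPONSE IN FLUX CURRENCY, (X2ᴸ) ⟸ (G∞) ∧ (Res)

Docket `stmt-AtomisticToContinuum-26636` (N = `…Theses.ChartedPlanarOrder.ChartedZeroExcessLayered`), cell decomp-a2c RESIDUAL MODE, lens-2
«structural dichotomy (special vs generic)», generation 69.  Node beneath the UNDECIDED piece (X2ᴸ) `LoadedTubeAprioriP` of part YO «LoadPath»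
(g68; critic rows 1250/1254).  v2 = the repair (r1)–(r3) of CRITIC-LEDGER row 1272 applied to the v1 bytes (622a9d18…, HELD, never landed):
(r1) the FLUX RADIUS `Rφ` is a dial SEPARATE from the tube's bond radius `Rg` (record candidate: the nearest-neighbour shell); (r2) the currency is
CLASS-SPLIT — bond-flux level `Mg`, interface boundary-flux level `MI`, bulk boundary-flux level `Mb` — and (G∞) outputs a 3 × 3 CONSTANT MATRIX
`C_{k,c}`, `k ∈ {s, I, B}` (bond strain, interface displacement, bulk displacement), `c ∈ {g, I, b}`; (r3) NO numerals for the matrix or the levels in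
this file: the constants come from the exact dual (Green's-row) formula, instrument «GreenRow-T» (row 1272 (D)); only the record GEOMETRY is
instanced.  First order throughout (no Hessian object); the junction is PROVED.

## The node

  (X2ᴸ) `LoadedTubeAprioriP … Rg sb dI dB sb₁ dI₁ dB₁ …`
    ⟸ (G∞) `TubeResponseP … Rg sb dI dB Rφ CsG CsI CsB CIG CII CIB CBG CBI CBB …`   [LINEAR-RESPONSE · ANALYTIC · HEAVY · UNDECIDED · INSTRUMENTABLE «GreenRow-T»]
     ∧ (Res) `ReferenceLoadP … Rg sb dI dB Rφ εg εI εb …`                            [KINEMATIC-ANALYTIC · ATTACKABLE · INSTRUMENTABLE «RefLoad-T»]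
     ∧ `0 ≤ εg, εI, εb`, `Σ_c Cs_c·ε_c ≤ sb₁`, `Σ_c CI_c·ε_c ≤ dI₁`, `Σ_c CB_c·ε_c ≤ dB₁`  [arithmetic]
  junction `loadedTubeAprioriP_of_response` PROVED (both pieces and the arithmetic load-bearing; inner radii, `Rφ`, levels and matrix free).

* THE CURRENCY (§YQ-1).  A load `φ : (Fin n → E3) →L[ℝ] ℝ` on the enumerated core HAS TUBE FLUX LEVELS `(Mg, MI, Mb)` about the reference `y₀`
  (`HasTubeFluxLoad X Rg Rφ Mg MI Mb y₀ φ`) if its site forces are a DIVERGENCE PLUS BOUNDARY FLUX, `force i = Σⱼ g i j + b i`, with `g`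
  antisymmetric, supported on the reference's `Rφ`-pairs, `‖g i j‖ ≤ Mg`; `‖b i‖ ≤ MI` at the INTERFACE sites (a point of the clamped exterior `X`
  within `Rg` of `y₀ i` — the tube's own partition) and `‖b i‖ ≤ Mb` at the BULK sites.  By LP duality the sharp response constant of a class is the
  `ℓ¹` ROW SUM of the clamped Green's function over that class (row 1272 (B)): `C_{B,g} = Σ_{pairs ≤ Rφ} ‖G(x,i) − G(x,j)‖` is large (and `∝` the
  partner count, hence `Rφ` = nearest neighbours), while the interface-class sums `C_{·,I}` are `O(1)` — and the reference's residual is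
  interface-dominated.  Levels ADD under addition of loads (`HasTubeFluxLoad.add`), SCALE under `|c| ≤ 1` (`.smul`), and the sitewise bound
  (`g = 0`) is the sub-case `hasTubeFluxLoad_of_site_forces`.
* (G∞) `TubeResponseP` — LINEAR RESPONSE IN TUBE GEOMETRY, uniform over the tube's secant (= stiffness) class: for every tube reference `y₀`
  (`φ₀ = D E(y₀)`, `E` = clamped energy of the exterior `X = S ∖ core`) and every member `z` of the OUTER tube with `D E(z) = φ`: if `φ − φ₀` has
  levels `(Mg, MI, Mb) ≥ 0` then `z ∈ bondTube X Rg (Σ_c Cs_c M_c) (Σ_c CI_c M_c) (Σ_c CB_c M_c) y₀`.  Since `φ − φ₀ = H̄(z)(z − y₀)` with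
  `H̄(z) = ∫₀¹ D²E(y₀ + s(z − y₀)) ds`, this is the max-norm bound for the inverses of the whole class `{H̄(z)}` in divergence form (row 1250),
  first order.  At zero levels it is tube RIGIDITY (`TubeResponseP.eq_reference`, PROVED).
* (Res) `ReferenceLoadP` — the reference's residual `φ₀ = D E(y₀)` has class levels `(εg, εI, εb)`; `φ₀` counts every interaction (collar misfit,
  the reference's own roughness, the far-field tail — continuum tail `≈ 0.002` per interface site at `D = 4`, g69 addendum 1).
* JUNCTION (PROVED): `(1 − t)·φ₀ − φ₀ = −t·φ₀` keeps the levels (`|−t| ≤ 1`); (G∞) at `(εg, εI, εb)`; `bondTube_mono` with the arithmetic.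

## Lens reading (special vs generic)
The dichotomy is on LOADS: GENERIC (rough) loads are divergences of short fluxes and relax locally; SPECIAL (coherent) loads are boundary fluxes or
long routings exciting the collective modes whose gain grows with the core radius.  The exhaustion lemma is LP duality — every load is a
divergence plus boundary flux and its minimal class levels are its dual norms; the class matrix is the bookkeeping that lets small interface-class
residuals meet `O(1)` interface-class gains while the large bulk-flux gains meet `≈ 10⁻⁴` bulk-flux residuals (row 1272 (C)).

## Dials (census decides — «GreenRow-T»: the nine class constants from one sparse factorisation of the clamped stiffness per sample core, with their
growth in the core radius; «RefLoad-T»: the minimal class levels of `D E(y₀)` per sample, one LP)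
Record geometry only (`loadedTubeAprioriP_record_of_response`, `response_dial_record`): moat/fill/core `(1/2000, 1/100, 1/10)`, radii `8 4 12 16 16`,
`dm = 1/2`, `ϑ₀ = 1/400`, `Rg = 5`, outer tube `(3/400, 3/400, 3/10)`, inner `(1/200, 1/200, 3/20)`; `Rφ`, the matrix and the levels stay SYMBOLIC,
the cut closes at a dial set iff `Σ_c C_{k,c}·ε_c ≤ (1/200, 1/200, 3/20)_k` (critic's pre-registration: `C_{B,I} ≈ 2–4`, `C_{I,I} ≈ 0.2–0.5`,
`C_{B,g}(nn) ≈ 5–15`; interface residual `≈ 0.005–0.011`, bulk-flux residual `≈ 10⁻⁴–10⁻³`).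

## Why each piece might fail
(G∞): growth of the Green's-row sums with the core radius (`C_{·,g} ∝ ρ`, `C_{I,·} ∝ log ρ`); secant drift `≈ 21·sb` across a fat tube; soft
under-coordinated interface stars.  (Res): registry-coherent collar misfit `> 2ϑm` per bond; adversarial `ϑ₀`-rough references; one-sided clustering of
the far door set above lattice density.

## Sources
E–Ming, ARMA 183 (2007) 241; Ortner–Theil, ARMA 207 (2013) 1025; Ehrlacher–Ortner–Shapeev, ARMA 222 (2016) 1217 (clamped lattice Green's functions,
`W^{-1,p}` residual norms); Ortner–Shapeev, arXiv:1204.3705 §4 (bond-flux representation of residuals); part YO (g68) docstrings of (X2ᴸ); CRITIC-LEDGER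
rows 1237, 1250, 1254, 1272 ((B) Green's-row count, (C) repair (r1)–(r3), (D) GreenRow-T).  0 sorry; standard axioms.
-/

noncomputable section
open scoped BigOperators Classical InnerProductSpace RealInnerProductSpace
open MeasureTheory Set Metric Filter Topology
open Summit.AtomisticToContinuum.Crystallization.Theorems.ChartedPlanarOrderRigidityDoor (E3 eStar atomsIn IsEStarGSC siteEnergy VisibleGap PertRegime)
open Summit.AtomisticToContinuum.Crystallization.Theorems.ChartedPlanarOrderDensityDichotomy (μS IsSep nK nK_nonneg)
open Summit.AtomisticToContinuum.Crystallization.Theorems.ChartedPlanarOrderCleanScaleP (IsCleanP IsDoorSetP)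
open Summit.AtomisticToContinuum.Crystallization.Theorems.ChartedPlanarOrderMesoCut (LayeredHom EnvClose)
open Summit.AtomisticToContinuum.Crystallization.Theorems.ChartedPlanarOrderDoorLayered (atomsIn_subset sq_le_finsum_mem PeriodicBulkGapDoor)
open Summit.AtomisticToContinuum.Crystallization.Theorems.ChartedPlanarOrderDoorLayeredOsc (IsTwoShellAffineGood)
open Literature.MathematicalPhysics.StatisticalMechanics (card_le_of_separated_of_dist_le lennardJones interactionEnergy)

namespace Summit.AtomisticToContinuum.Crystallization.Theorems.ChartedZeroExcessLayeredLatticeLiouville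

/-! ### YQ-1  The class-split flux currency for loads on an enumerated core -/

section FluxLoad

variable {n : ℕ}

/-- **`IsFluxRep φ g b`** — the load `φ` (a linear functional on core configurations) is REPRESENTED by the bond fluxes `g i j : E3` and the boundary
fluxes `b i : E3`: its force on site `i` is `Σⱼ g i j + b i`, i.e. `φ v = Σᵢ ⟪Σⱼ g i j + b i, v i⟫`. [this file, g69] -/
def IsFluxRep (φ : (Fin n → E3) →L[ℝ] ℝ) (g : Fin n → Fin n → E3) (b : Fin n → E3) : Prop :=
  ∀ v : Fin n → E3, φ v = ∑ i, ⟪(∑ j, g i j) + b i, v i⟫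

/-- **`IsTubeFlux X Rg Rφ Mg MI Mb y₀ g b`** — `(g, b)` is an ADMISSIBLE FLUX OF CLASS LEVELS `(Mg, MI, Mb)` about the reference `y₀` in the frozen
field of `X`: `g` is antisymmetric (action = reaction), supported on the pairs with `dist (y₀ i, y₀ j) ≤ Rφ` (the FLUX RADIUS, a dial separate from the
tube's bond radius `Rg`; record candidate: the nearest-neighbour shell), `‖g i j‖ ≤ Mg`; the boundary flux has `‖b i‖ ≤ MI` at the INTERFACE sites (a
point of `X` within `Rg` of `y₀ i`) and `‖b i‖ ≤ Mb` at the BULK sites (no such point). [this file, g69 v2 — row 1272 (r1)/(r2)] -/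
def IsTubeFlux (X : Set E3) (Rg Rφ Mg MI Mb : ℝ) (y₀ : Fin n → E3) (g : Fin n → Fin n → E3) (b : Fin n → E3) : Prop :=
  (∀ i j, g j i = -g i j) ∧ (∀ i j, Rφ < dist (y₀ i) (y₀ j) → g i j = 0) ∧ (∀ i j, ‖g i j‖ ≤ Mg) ∧
    (∀ i, (∃ p ∈ X, dist (y₀ i) p ≤ Rg) → ‖b i‖ ≤ MI) ∧ ∀ i, (¬ ∃ p ∈ X, dist (y₀ i) p ≤ Rg) → ‖b i‖ ≤ Mb

/-- ★★ **`HasTubeFluxLoad X Rg Rφ Mg MI Mb y₀ φ`** — the load `φ` HAS TUBE FLUX LEVELS `(Mg, MI, Mb)`: it admits an admissible flux representation of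
these class levels.  The class-split discrete `W^{-1,∞}`-type («divergence-form») size of a load relative to the reference's `Rφ`-graph and the
interface/bulk partition of the tube; the minimal levels are LP-dual to Green's-row sums (row 1272 (B)). [this file, g69 v2] -/
def HasTubeFluxLoad (X : Set E3) (Rg Rφ Mg MI Mb : ℝ) (y₀ : Fin n → E3) (φ : (Fin n → E3) →L[ℝ] ℝ) : Prop :=
  ∃ (g : Fin n → Fin n → E3) (b : Fin n → E3), IsTubeFlux X Rg Rφ Mg MI Mb y₀ g b ∧ IsFluxRep φ g b

variable {X : Set E3} {Rg Rφ Mg MI Mb : ℝ} {y₀ : Fin n → E3}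

/-- the represented load's force on site `i`, read off on a single-site test displacement. [this file, g69] -/
theorem IsFluxRep.apply_single {φ : (Fin n → E3) →L[ℝ] ℝ} {g : Fin n → Fin n → E3} {b : Fin n → E3} (h : IsFluxRep φ g b)
    (i : Fin n) (v : E3) : φ (Pi.single i v) = ⟪(∑ j, g i j) + b i, v⟫ := by
  rw [h, Finset.sum_eq_single i (fun k _ hki => by rw [Pi.single_eq_of_ne hki, inner_zero_right])
    (fun hi => absurd (Finset.mem_univ i) hi), Pi.single_eq_same]

/-- flux representations SCALE. [this file, g69] -/
theorem IsFluxRep.smul {φ : (Fin n → E3) →L[ℝ] ℝ} {g : Fin n → Fin n → E3} {b : Fin n → E3} (h : IsFluxRep φ g b) (c : ℝ) :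
    IsFluxRep (c • φ) (fun i j => c • g i j) (fun i => c • b i) := by
  intro v
  rw [smul_apply, h v, smul_eq_mul, Finset.mul_sum]
  refine Finset.sum_congr rfl fun i _ => ?_
  rw [← real_inner_smul_left, smul_add, Finset.smul_sum]

/-- flux representations ADD. [this file, g69] -/
theorem IsFluxRep.add {φ₁ φ₂ : (Fin n → E3) →L[ℝ] ℝ} {g₁ g₂ : Fin n → Fin n → E3} {b₁ b₂ : Fin n → E3} (h₁ : IsFluxRep φ₁ g₁ b₁)
    (h₂ : IsFluxRep φ₂ g₂ b₂) : IsFluxRep (φ₁ + φ₂) (fun i j => g₁ i j + g₂ i j) (fun i => b₁ i + b₂ i) := by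
  intro v
  show (φ₁ + φ₂) v = ∑ i, ⟪(∑ j, (g₁ i j + g₂ i j)) + (b₁ i + b₂ i), v i⟫
  rw [add_apply, h₁ v, h₂ v, ← Finset.sum_add_distrib]
  refine Finset.sum_congr rfl fun i _ => ?_
  rw [← inner_add_left, Finset.sum_add_distrib, add_add_add_comm]

/-- admissible fluxes are stable under scaling by `|c| ≤ 1` (all three levels kept). [this file, g69 v2] -/
theorem IsTubeFlux.smul {g : Fin n → Fin n → E3} {b : Fin n → E3} (h : IsTubeFlux X Rg Rφ Mg MI Mb y₀ g b) {c : ℝ} (hc : |c| ≤ 1) :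
    IsTubeFlux X Rg Rφ Mg MI Mb y₀ (fun i j => c • g i j) (fun i => c • b i) := by
  obtain ⟨hanti, hsupp, hg, hI, hB⟩ := h
  refine ⟨fun i j => by simp only [hanti i j, smul_neg], fun i j hij => by simp only [hsupp i j hij, smul_zero], fun i j => ?_,
    fun i hi => ?_, fun i hi => ?_⟩
  · rw [norm_smul, Real.norm_eq_abs]
    exact (mul_le_mul hc (hg i j) (norm_nonneg _) zero_le_one).trans_eq (one_mul _)
  · rw [norm_smul, Real.norm_eq_abs]
    exact (mul_le_mul hc (hI i hi) (norm_nonneg _) zero_le_one).trans_eq (one_mul _)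
  · rw [norm_smul, Real.norm_eq_abs]
    exact (mul_le_mul hc (hB i hi) (norm_nonneg _) zero_le_one).trans_eq (one_mul _)

/-- admissible fluxes are MONOTONE in the three levels. [this file, g69 v2] -/
theorem IsTubeFlux.mono {Mg' MI' Mb' : ℝ} {g : Fin n → Fin n → E3} {b : Fin n → E3} (h : IsTubeFlux X Rg Rφ Mg MI Mb y₀ g b)
    (hg : Mg ≤ Mg') (hI : MI ≤ MI') (hB : Mb ≤ Mb') : IsTubeFlux X Rg Rφ Mg' MI' Mb' y₀ g b :=
  ⟨h.1, h.2.1, fun i j => (h.2.2.1 i j).trans hg, fun i hi => (h.2.2.2.1 i hi).trans hI, fun i hi => (h.2.2.2.2 i hi).trans hB⟩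

/-- admissible fluxes are MONOTONE in the flux radius (a larger `Rφ` admits more fluxes). [this file, g69 v2] -/
theorem IsTubeFlux.radius_mono {Rφ' : ℝ} {g : Fin n → Fin n → E3} {b : Fin n → E3} (h : IsTubeFlux X Rg Rφ Mg MI Mb y₀ g b)
    (hR : Rφ ≤ Rφ') : IsTubeFlux X Rg Rφ' Mg MI Mb y₀ g b :=
  ⟨h.1, fun i j hij => h.2.1 i j (lt_of_le_of_lt hR hij), h.2.2⟩

/-- admissible fluxes ADD, class levels add. [this file, g69 v2] -/
theorem IsTubeFlux.add {Mg₁ MI₁ Mb₁ Mg₂ MI₂ Mb₂ : ℝ} {g₁ g₂ : Fin n → Fin n → E3} {b₁ b₂ : Fin n → E3}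
    (h₁ : IsTubeFlux X Rg Rφ Mg₁ MI₁ Mb₁ y₀ g₁ b₁) (h₂ : IsTubeFlux X Rg Rφ Mg₂ MI₂ Mb₂ y₀ g₂ b₂) :
    IsTubeFlux X Rg Rφ (Mg₁ + Mg₂) (MI₁ + MI₂) (Mb₁ + Mb₂) y₀ (fun i j => g₁ i j + g₂ i j) (fun i => b₁ i + b₂ i) := by
  obtain ⟨a₁, s₁, n₁, c₁, k₁⟩ := h₁
  obtain ⟨a₂, s₂, n₂, c₂, k₂⟩ := h₂
  refine ⟨fun i j => ?_, fun i j hij => ?_, fun i j => (norm_add_le _ _).trans (add_le_add (n₁ i j) (n₂ i j)),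
    fun i hi => (norm_add_le _ _).trans (add_le_add (c₁ i hi) (c₂ i hi)),
    fun i hi => (norm_add_le _ _).trans (add_le_add (k₁ i hi) (k₂ i hi))⟩
  · show g₁ j i + g₂ j i = -(g₁ i j + g₂ i j)
    rw [a₁ i j, a₂ i j, neg_add]
  · show g₁ i j + g₂ i j = 0
    rw [s₁ i j hij, s₂ i j hij, add_zero]

/-- ★ **SUBADDITIVITY (PROVED)**: class levels ADD under addition of loads — the glue of the later split of (Res) into collar-misfit,
reference-roughness and far-field parts. [this file, g69 v2] -/
theorem HasTubeFluxLoad.add {Mg₁ MI₁ Mb₁ Mg₂ MI₂ Mb₂ : ℝ} {φ₁ φ₂ : (Fin n → E3) →L[ℝ] ℝ}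
    (h₁ : HasTubeFluxLoad X Rg Rφ Mg₁ MI₁ Mb₁ y₀ φ₁) (h₂ : HasTubeFluxLoad X Rg Rφ Mg₂ MI₂ Mb₂ y₀ φ₂) :
    HasTubeFluxLoad X Rg Rφ (Mg₁ + Mg₂) (MI₁ + MI₂) (Mb₁ + Mb₂) y₀ (φ₁ + φ₂) := by
  obtain ⟨g₁, b₁, hf₁, hr₁⟩ := h₁
  obtain ⟨g₂, b₂, hf₂, hr₂⟩ := h₂
  exact ⟨_, _, hf₁.add hf₂, hr₁.add hr₂⟩

/-- ★ **SCALING (PROVED)**: a load scaled by `|c| ≤ 1` keeps its class levels — the step of the junction (`c = −t`). [this file, g69] -/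
theorem HasTubeFluxLoad.smul {φ : (Fin n → E3) →L[ℝ] ℝ} (h : HasTubeFluxLoad X Rg Rφ Mg MI Mb y₀ φ) {c : ℝ} (hc : |c| ≤ 1) :
    HasTubeFluxLoad X Rg Rφ Mg MI Mb y₀ (c • φ) := by
  obtain ⟨g, b, hflux, hrep⟩ := h
  exact ⟨_, _, hflux.smul hc, hrep.smul c⟩

/-- class levels are MONOTONE. [this file, g69 v2] -/
theorem HasTubeFluxLoad.mono {Mg' MI' Mb' : ℝ} {φ : (Fin n → E3) →L[ℝ] ℝ} (h : HasTubeFluxLoad X Rg Rφ Mg MI Mb y₀ φ)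
    (hg : Mg ≤ Mg') (hI : MI ≤ MI') (hB : Mb ≤ Mb') : HasTubeFluxLoad X Rg Rφ Mg' MI' Mb' y₀ φ := by
  obtain ⟨g, b, hflux, hrep⟩ := h
  exact ⟨g, b, hflux.mono hg hI hB, hrep⟩

/-- class levels are MONOTONE in the flux radius. [this file, g69 v2] -/
theorem HasTubeFluxLoad.radius_mono {Rφ' : ℝ} {φ : (Fin n → E3) →L[ℝ] ℝ} (h : HasTubeFluxLoad X Rg Rφ Mg MI Mb y₀ φ) (hR : Rφ ≤ Rφ') :
    HasTubeFluxLoad X Rg Rφ' Mg MI Mb y₀ φ := by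
  obtain ⟨g, b, hflux, hrep⟩ := h
  exact ⟨g, b, hflux.radius_mono hR, hrep⟩

/-- the zero load has every triple of nonnegative class levels. [this file, g69 v2] -/
theorem hasTubeFluxLoad_zero (hg : 0 ≤ Mg) (hI : 0 ≤ MI) (hB : 0 ≤ Mb) :
    HasTubeFluxLoad X Rg Rφ Mg MI Mb y₀ (0 : (Fin n → E3) →L[ℝ] ℝ) :=
  ⟨fun _ _ => 0, fun _ => 0, ⟨fun _ _ => by rw [neg_zero], fun _ _ _ => rfl, fun _ _ => by rw [norm_zero]; exact hg,
    fun _ _ => by rw [norm_zero]; exact hI, fun _ _ => by rw [norm_zero]; exact hB⟩, fun v => by simp⟩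

/-- ★ **the SITEWISE special case (`g = 0`, PROVED)**: a load whose site forces are `≤ MI` at the interface sites and `≤ Mb` at the bulk sites has
class levels `(Mg, MI, Mb)` for every `Mg ≥ 0` — the `ℓ∞`-per-site residual bound of CRITIC-LEDGER row 1250 (Res) is this sub-case.
[this file, g69 v2] -/
theorem hasTubeFluxLoad_of_site_forces {φ : (Fin n → E3) →L[ℝ] ℝ} {f : Fin n → E3} (hφ : ∀ v, φ v = ∑ i, ⟪f i, v i⟫) (hg : 0 ≤ Mg)
    (hI : ∀ i, (∃ p ∈ X, dist (y₀ i) p ≤ Rg) → ‖f i‖ ≤ MI) (hB : ∀ i, (¬ ∃ p ∈ X, dist (y₀ i) p ≤ Rg) → ‖f i‖ ≤ Mb) :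
    HasTubeFluxLoad X Rg Rφ Mg MI Mb y₀ φ :=
  ⟨fun _ _ => 0, f, ⟨fun _ _ => by rw [neg_zero], fun _ _ _ => rfl, fun _ _ => by rw [norm_zero]; exact hg, hI, hB⟩,
    fun v => by simp only [Finset.sum_const_zero, zero_add]; exact hφ v⟩

end FluxLoad

/-! ### YQ-2  The two pieces (G∞) / (Res) (typed; binders of (X2ᴸ) verbatim; matrix and levels symbolic) -/

section FluxResponse

/-- ★★★ **(G∞) «TubeResponseP … Rg sb dI dB Rφ CsG CsI CsB CIG CII CIB CBG CBI CBB …» — CLASS-SPLIT LINEAR RESPONSE IN TUBE GEOMETRY, UNIFORM OVER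
THE TUBE'S STIFFNESS CLASS.**  Under the binders of (X2ᴸ) verbatim, for every tube reference `y₀` with `φ₀ := D(clampedEnergy)(y₀)` and every
member `z` of the OUTER tube `bondTube (S ∖ core) Rg sb dI dB y₀` at which the clamped energy has derivative `φ`: if `φ − φ₀` has class levels
`(Mg, MI, Mb) ≥ 0` about `y₀` (flux radius `Rφ`), then `z` lies in the RESPONSE TUBE
`bondTube (S ∖ core) Rg (CsG·Mg + CsI·MI + CsB·Mb) (CIG·Mg + CII·MI + CIB·Mb) (CBG·Mg + CBI·MI + CBB·Mb) y₀`.  For `C²` energies this is the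
max-norm bound `‖z − y₀‖_k ≤ Σ_c C_{k,c}·‖H̄(z)(z − y₀)‖_c` for EVERY secant stiffness `H̄(z) = ∫₀¹ D²E(y₀ + s(z − y₀)) ds`, `z` in the tube (row 1250
(G∞)), first order; the sharp constants are the class-wise Green's-row sums (row 1272 (B)/(r3); instrument «GreenRow-T»).  At zero levels it is
tube RIGIDITY (`TubeResponseP.eq_reference`).  ANALYTIC · HEAVY · UNDECIDED · SIDEWAYS w.r.t. (X2ᴸ).
Why it might fail: growth of the row sums with the core radius (`C_{·,g} ∝ ρ` at fixed `Rφ`, interface dipole sums `∝ log ρ`); secant stiffness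
drift `≈ 21·sb` across a fat tube; under-coordinated interface stars softer than the harmonic clamp.
Sources: E–Ming 2007; Ortner–Theil 2013; Ehrlacher–Ortner–Shapeev 2016; Ortner–Shapeev arXiv:1204.3705 §4; part YO (X2ᴸ); CRITIC-LEDGER rows 1250,
1272. [this file, g69 v2] -/
def TubeResponseP (ϑc ϑ ϑp r q rsh ρ rm dm ϑ₀ Rg sb dI dB Rφ CsG CsI CsB CIG CII CIB CBG CBI CBB aHi Λ θ s : ℝ) : Prop :=
  ∀ δ : ℝ, 0 < δ → ∀ a : ℝ, 0 < a →
    ∀ S : Set E3, IsDoorSetP aHi δ S → (∀ z : E3, Summable fun y : S => lennardJones (dist z (y : E3))) →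
      (∀ p ∈ S, IsTwoShellAffineGood θ S p) →
        ∀ (L : E3 ≃L[ℝ] E3) (w : ℤ → E3), IsEquilChart a s Λ L w →
          ∀ (x₀ : E3) (K : Set E3), K ⊆ S → (∀ k ∈ K, dist k x₀ ≤ q) →
            IsTameOn ϑp S (LayeredHom (L : E3 →L[ℝ] E3) w) (coreOf S K rm) →
              IsTameOn ϑc S (LayeredHom (L : E3 →L[ℝ] E3) w) (moatIn S K r (r + rsh)) →
                ∀ (n : ℕ) (xf : Fin n → E3), Function.Injective xf → Set.range xf = coreOf S K ρ →
                  ∀ y₀ : Fin n → E3, IsTubeReference ϑ₀ ϑ dm Rg sb dI dB (S \ coreOf S K ρ) (LayeredHom (L : E3 →L[ℝ] E3) w) xf y₀ →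
                    ∀ φ₀ : (Fin n → E3) →L[ℝ] ℝ, HasFDerivAt (fun z : Fin n → E3 => clampedEnergy (S \ coreOf S K ρ) z) φ₀ y₀ →
                      ∀ z ∈ bondTube (S \ coreOf S K ρ) Rg sb dI dB y₀, ∀ φ : (Fin n → E3) →L[ℝ] ℝ,
                        HasFDerivAt (fun z : Fin n → E3 => clampedEnergy (S \ coreOf S K ρ) z) φ z →
                          ∀ Mg MI Mb : ℝ, 0 ≤ Mg → 0 ≤ MI → 0 ≤ Mb →
                            HasTubeFluxLoad (S \ coreOf S K ρ) Rg Rφ Mg MI Mb y₀ (φ - φ₀) →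
                              z ∈ bondTube (S \ coreOf S K ρ) Rg (CsG * Mg + CsI * MI + CsB * Mb) (CIG * Mg + CII * MI + CIB * Mb)
                                (CBG * Mg + CBI * MI + CBB * Mb) y₀

/-- ★★ **(Res) «ReferenceLoadP … Rg sb dI dB Rφ εg εI εb …» — THE REFERENCE'S RESIDUAL LOAD HAS SMALL CLASS LEVELS.**  Under the binders of (X2ᴸ)
verbatim, for every tube reference `y₀`: its residual load `φ₀ = D(clampedEnergy)(y₀)` has class levels `(εg, εI, εb)` about `y₀` (flux radius
`Rφ`).  `φ₀` counts every interaction of the core with itself and with the WHOLE exterior — the cold collar (`ϑc`-tame moat: interface-class misfit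
`≈ V″·(1–2)ϑc` per exterior bond), the reference's own `ϑ₀`-roughness (bond-flux class, `≲ V″(a₀)·ϑ₀` routed on nearest neighbours), and the far
field beyond the moat (continuum tail `≈ 0.002` per interface site at `D = 4`, `≤ 10⁻⁴` at bulk sites; g69 addendum 1).  KINEMATIC-ANALYTIC ·
ATTACKABLE · WEAKER than (X2ᴸ) (no equation is solved) · INSTRUMENTABLE «RefLoad-T» (minimal class levels of `D E(y₀)` per sampled core: one LP).
Why it might fail: registry-coherent collar misfit larger than `2ϑc` per bond; adversarial `ϑ₀`-rough references (`ϑ₀ = 1/400` costs `≈ 11·ϑ₀` of bond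
flux); one-sided clustering of the far door set above lattice density.
Sources: part YO (XR)/(X2ᴸ) docstrings; Ortner–Shapeev arXiv:1204.3705 §4; E–Ming 2007 §2; CRITIC-LEDGER rows 1237 (F3), 1250, 1272 (D). [this file, g69 v2] -/
def ReferenceLoadP (ϑc ϑ ϑp r q rsh ρ rm dm ϑ₀ Rg sb dI dB Rφ εg εI εb aHi Λ θ s : ℝ) : Prop :=
  ∀ δ : ℝ, 0 < δ → ∀ a : ℝ, 0 < a →
    ∀ S : Set E3, IsDoorSetP aHi δ S → (∀ z : E3, Summable fun y : S => lennardJones (dist z (y : E3))) →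
      (∀ p ∈ S, IsTwoShellAffineGood θ S p) →
        ∀ (L : E3 ≃L[ℝ] E3) (w : ℤ → E3), IsEquilChart a s Λ L w →
          ∀ (x₀ : E3) (K : Set E3), K ⊆ S → (∀ k ∈ K, dist k x₀ ≤ q) →
            IsTameOn ϑp S (LayeredHom (L : E3 →L[ℝ] E3) w) (coreOf S K rm) →
              IsTameOn ϑc S (LayeredHom (L : E3 →L[ℝ] E3) w) (moatIn S K r (r + rsh)) →
                ∀ (n : ℕ) (xf : Fin n → E3), Function.Injective xf → Set.range xf = coreOf S K ρ →
                  ∀ y₀ : Fin n → E3, IsTubeReference ϑ₀ ϑ dm Rg sb dI dB (S \ coreOf S K ρ) (LayeredHom (L : E3 →L[ℝ] E3) w) xf y₀ →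
                    ∀ φ₀ : (Fin n → E3) →L[ℝ] ℝ, HasFDerivAt (fun z : Fin n → E3 => clampedEnergy (S \ coreOf S K ρ) z) φ₀ y₀ →
                      HasTubeFluxLoad (S \ coreOf S K ρ) Rg Rφ εg εI εb y₀ φ₀

/-! ### YQ-3  THE JUNCTION (PROVED): (X2ᴸ) ⟸ (G∞) ∧ (Res) ∧ arithmetic; dials; rigidity at zero levels; the record-geometry corollary -/

/-- ★★★ **THE JUNCTION (PROVED): (G∞)(Rφ; C) ∧ (Res)(Rφ; ε ≥ 0) ∧ `Σ_c Cs_c·ε_c ≤ sb₁` ∧ `Σ_c CI_c·ε_c ≤ dI₁` ∧ `Σ_c CB_c·ε_c ≤ dB₁` ⇒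
(X2ᴸ)(sb₁, dI₁, dB₁).**  A loaded tube solution `z` has `D E(z) − φ₀ = (1 − t)·φ₀ − φ₀ = −t·φ₀`, of class levels `(εg, εI, εb)` by (Res) and scaling
(`|−t| ≤ 1`); (G∞) at these levels places `z` in the response tube, inside the inner tube by the arithmetic. [this file, g69 v2] -/
theorem loadedTubeAprioriP_of_response
    {ϑc ϑ ϑp r q rsh ρ rm dm ϑ₀ Rg sb dI dB Rφ CsG CsI CsB CIG CII CIB CBG CBI CBB εg εI εb sb₁ dI₁ dB₁ aHi Λ θ s : ℝ}
    (hεg : 0 ≤ εg) (hεI : 0 ≤ εI) (hεb : 0 ≤ εb)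
    (hs : CsG * εg + CsI * εI + CsB * εb ≤ sb₁) (hI : CIG * εg + CII * εI + CIB * εb ≤ dI₁) (hB : CBG * εg + CBI * εI + CBB * εb ≤ dB₁)
    (hG : TubeResponseP ϑc ϑ ϑp r q rsh ρ rm dm ϑ₀ Rg sb dI dB Rφ CsG CsI CsB CIG CII CIB CBG CBI CBB aHi Λ θ s)
    (hL : ReferenceLoadP ϑc ϑ ϑp r q rsh ρ rm dm ϑ₀ Rg sb dI dB Rφ εg εI εb aHi Λ θ s) :
    LoadedTubeAprioriP ϑc ϑ ϑp r q rsh ρ rm dm ϑ₀ Rg sb dI dB sb₁ dI₁ dB₁ aHi Λ θ s := by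
  intro δ hδ a ha S hS hsum hgood L w hLw x₀ K hKS hKq hmild hcool n xf hxf hrange y₀ hy₀ φ₀ hφ₀ t ht0 ht1 z hz hcrit
  have hload : HasTubeFluxLoad (S \ coreOf S K ρ) Rg Rφ εg εI εb y₀ ((1 - t) • φ₀ - φ₀) := by
    have e : (1 - t) • φ₀ - φ₀ = (-t) • φ₀ := by
      ext v; simp only [sub_apply, smul_apply, smul_eq_mul]; ring
    rw [e]
    exact (hL δ hδ a ha S hS hsum hgood L w hLw x₀ K hKS hKq hmild hcool n xf hxf hrange y₀ hy₀ φ₀ hφ₀).smul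
      (by rw [abs_neg, abs_of_nonneg ht0]; exact ht1)
  exact bondTube_mono hs hI hB
    (hG δ hδ a ha S hS hsum hgood L w hLw x₀ K hKS hKq hmild hcool n xf hxf hrange y₀ hy₀ φ₀ hφ₀ z hz _ hcrit εg εI εb hεg hεI hεb hload)

/-- **DIAL (PROVED): (Res) is WEAKER for larger levels.** [this file, g69 v2] -/
theorem ReferenceLoadP.of_le {ϑc ϑ ϑp r q rsh ρ rm dm ϑ₀ Rg sb dI dB Rφ εg εI εb εg' εI' εb' aHi Λ θ s : ℝ}
    (hg : εg ≤ εg') (hI : εI ≤ εI') (hB : εb ≤ εb') (hL : ReferenceLoadP ϑc ϑ ϑp r q rsh ρ rm dm ϑ₀ Rg sb dI dB Rφ εg εI εb aHi Λ θ s) :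
    ReferenceLoadP ϑc ϑ ϑp r q rsh ρ rm dm ϑ₀ Rg sb dI dB Rφ εg' εI' εb' aHi Λ θ s :=
  fun δ hδ a ha S hS hsum hgood L w hLw x₀ K hKS hKq hmild hcool n xf hxf hrange y₀ hy₀ φ₀ hφ₀ =>
    (hL δ hδ a ha S hS hsum hgood L w hLw x₀ K hKS hKq hmild hcool n xf hxf hrange y₀ hy₀ φ₀ hφ₀).mono hg hI hB

/-- **DIAL (PROVED): (Res) is WEAKER for a larger flux radius; (G∞) is WEAKER for a smaller one** — `Rφ` trades between the pieces (row 1272 (r1)).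
[this file, g69 v2] -/
theorem ReferenceLoadP.of_radius_le {ϑc ϑ ϑp r q rsh ρ rm dm ϑ₀ Rg sb dI dB Rφ Rφ' εg εI εb aHi Λ θ s : ℝ} (hR : Rφ ≤ Rφ')
    (hL : ReferenceLoadP ϑc ϑ ϑp r q rsh ρ rm dm ϑ₀ Rg sb dI dB Rφ εg εI εb aHi Λ θ s) :
    ReferenceLoadP ϑc ϑ ϑp r q rsh ρ rm dm ϑ₀ Rg sb dI dB Rφ' εg εI εb aHi Λ θ s :=
  fun δ hδ a ha S hS hsum hgood L w hLw x₀ K hKS hKq hmild hcool n xf hxf hrange y₀ hy₀ φ₀ hφ₀ =>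
    (hL δ hδ a ha S hS hsum hgood L w hLw x₀ K hKS hKq hmild hcool n xf hxf hrange y₀ hy₀ φ₀ hφ₀).radius_mono hR

/-- `TubeResponseP.of_radius_le` (docstring added by the landing lane; see the module docstring). [formal bookkeeping] -/
theorem TubeResponseP.of_radius_le {ϑc ϑ ϑp r q rsh ρ rm dm ϑ₀ Rg sb dI dB Rφ Rφ' CsG CsI CsB CIG CII CIB CBG CBI CBB aHi Λ θ s : ℝ}
    (hR : Rφ' ≤ Rφ) (hG : TubeResponseP ϑc ϑ ϑp r q rsh ρ rm dm ϑ₀ Rg sb dI dB Rφ CsG CsI CsB CIG CII CIB CBG CBI CBB aHi Λ θ s) :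
    TubeResponseP ϑc ϑ ϑp r q rsh ρ rm dm ϑ₀ Rg sb dI dB Rφ' CsG CsI CsB CIG CII CIB CBG CBI CBB aHi Λ θ s :=
  fun δ hδ a ha S hS hsum hgood L w hLw x₀ K hKS hKq hmild hcool n xf hxf hrange y₀ hy₀ φ₀ hφ₀ z hz φ hφ Mg MI Mb hMg hMI hMb hload =>
    hG δ hδ a ha S hS hsum hgood L w hLw x₀ K hKS hKq hmild hcool n xf hxf hrange y₀ hy₀ φ₀ hφ₀ z hz φ hφ Mg MI Mb hMg hMI hMb
      (hload.radius_mono hR)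

/-- **DIAL (PROVED): both pieces are WEAKER at a colder moat** (`ϑm ≤ ϑc`), like the three pieces of part YO. [this file, g69] -/
theorem TubeResponseP.of_moat_le {ϑm ϑc ϑ ϑp r q rsh ρ rm dm ϑ₀ Rg sb dI dB Rφ CsG CsI CsB CIG CII CIB CBG CBI CBB aHi Λ θ s : ℝ}
    (h : ϑm ≤ ϑc) (hG : TubeResponseP ϑc ϑ ϑp r q rsh ρ rm dm ϑ₀ Rg sb dI dB Rφ CsG CsI CsB CIG CII CIB CBG CBI CBB aHi Λ θ s) :
    TubeResponseP ϑm ϑ ϑp r q rsh ρ rm dm ϑ₀ Rg sb dI dB Rφ CsG CsI CsB CIG CII CIB CBG CBI CBB aHi Λ θ s :=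
  fun δ hδ a ha S hS hsum hgood L w hLw x₀ K hKS hKq hmild hcool =>
    hG δ hδ a ha S hS hsum hgood L w hLw x₀ K hKS hKq hmild (IsTameOn.mono h Subset.rfl hcool)

/-- `ReferenceLoadP.of_moat_le` (docstring added by the landing lane; see the module docstring). [formal bookkeeping] -/
theorem ReferenceLoadP.of_moat_le {ϑm ϑc ϑ ϑp r q rsh ρ rm dm ϑ₀ Rg sb dI dB Rφ εg εI εb aHi Λ θ s : ℝ} (h : ϑm ≤ ϑc)
    (hL : ReferenceLoadP ϑc ϑ ϑp r q rsh ρ rm dm ϑ₀ Rg sb dI dB Rφ εg εI εb aHi Λ θ s) :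
    ReferenceLoadP ϑm ϑ ϑp r q rsh ρ rm dm ϑ₀ Rg sb dI dB Rφ εg εI εb aHi Λ θ s :=
  fun δ hδ a ha S hS hsum hgood L w hLw x₀ K hKS hKq hmild hcool =>
    hL δ hδ a ha S hS hsum hgood L w hLw x₀ K hKS hKq hmild (IsTameOn.mono h Subset.rfl hcool)

/-- ★ **(G∞) at zero levels is TUBE RIGIDITY (PROVED)**: under (G∞), a tube member with the SAME derivative as the reference IS the reference — the
response bound has teeth (injectivity of `D E` on the tube relative to `y₀`, consistent with (X1) `tube_critical_unique_of_convexity`).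
[this file, g69] -/
theorem TubeResponseP.eq_reference {ϑc ϑ ϑp r q rsh ρ rm dm ϑ₀ Rg sb dI dB Rφ CsG CsI CsB CIG CII CIB CBG CBI CBB aHi Λ θ s : ℝ}
    (hG : TubeResponseP ϑc ϑ ϑp r q rsh ρ rm dm ϑ₀ Rg sb dI dB Rφ CsG CsI CsB CIG CII CIB CBG CBI CBB aHi Λ θ s) :
    ∀ δ : ℝ, 0 < δ → ∀ a : ℝ, 0 < a →
      ∀ S : Set E3, IsDoorSetP aHi δ S → (∀ z : E3, Summable fun y : S => lennardJones (dist z (y : E3))) →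
        (∀ p ∈ S, IsTwoShellAffineGood θ S p) →
          ∀ (L : E3 ≃L[ℝ] E3) (w : ℤ → E3), IsEquilChart a s Λ L w →
            ∀ (x₀ : E3) (K : Set E3), K ⊆ S → (∀ k ∈ K, dist k x₀ ≤ q) →
              IsTameOn ϑp S (LayeredHom (L : E3 →L[ℝ] E3) w) (coreOf S K rm) →
                IsTameOn ϑc S (LayeredHom (L : E3 →L[ℝ] E3) w) (moatIn S K r (r + rsh)) →
                  ∀ (n : ℕ) (xf : Fin n → E3), Function.Injective xf → Set.range xf = coreOf S K ρ →
                    ∀ y₀ : Fin n → E3, IsTubeReference ϑ₀ ϑ dm Rg sb dI dB (S \ coreOf S K ρ) (LayeredHom (L : E3 →L[ℝ] E3) w) xf y₀ →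
                      ∀ φ₀ : (Fin n → E3) →L[ℝ] ℝ, HasFDerivAt (fun z : Fin n → E3 => clampedEnergy (S \ coreOf S K ρ) z) φ₀ y₀ →
                        ∀ z ∈ bondTube (S \ coreOf S K ρ) Rg sb dI dB y₀,
                          HasFDerivAt (fun z : Fin n → E3 => clampedEnergy (S \ coreOf S K ρ) z) φ₀ z → z = y₀ := by
  intro δ hδ a ha S hS hsum hgood L w hLw x₀ K hKS hKq hmild hcool n xf hxf hrange y₀ hy₀ φ₀ hφ₀ z hz hcrit
  have hload : HasTubeFluxLoad (S \ coreOf S K ρ) Rg Rφ 0 0 0 y₀ (φ₀ - φ₀) := by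
    rw [sub_self]; exact hasTubeFluxLoad_zero le_rfl le_rfl le_rfl
  have h0 := hG δ hδ a ha S hS hsum hgood L w hLw x₀ K hKS hKq hmild hcool n xf hxf hrange y₀ hy₀ φ₀ hφ₀ z hz φ₀ hcrit 0 0 0
    le_rfl le_rfl le_rfl hload
  funext i
  have hi := h0.2.2 i
  simp only [mul_zero, add_zero] at hi
  exact dist_le_zero.1 hi

/-- ★ **THE RECORD GEOMETRY (PROVED; matrix, levels and flux radius SYMBOLIC — row 1272 (r3))**: at the record's moat/fill/core tameness
`(1/2000, 1/100, 1/10)`, radii `8 4 12 16 16`, `dm = 1/2`, reference tameness `ϑ₀ = 1/400`, `Rg = 5`, outer tube `(3/400, 3/400, 3/10)`: (G∞)(Rφ; C)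
∧ (Res)(Rφ; ε) ∧ `Σ_c C_{k,c}·ε_c ≤ (1/200, 1/200, 3/20)_k` give EXACTLY the `hA` slot of `loadPath_dial_instance` (part YO).  The cut CLOSES at a dial
set iff the three inequalities hold for the measured Green's-row constants and residual levels («GreenRow-T» × «RefLoad-T»). [this file, g69 v2] -/
theorem loadedTubeAprioriP_record_of_response {Rφ CsG CsI CsB CIG CII CIB CBG CBI CBB εg εI εb : ℝ}
    (hεg : 0 ≤ εg) (hεI : 0 ≤ εI) (hεb : 0 ≤ εb) (hs : CsG * εg + CsI * εI + CsB * εb ≤ 1 / 200)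
    (hI : CIG * εg + CII * εI + CIB * εb ≤ 1 / 200) (hB : CBG * εg + CBI * εI + CBB * εb ≤ 3 / 20)
    (hG : TubeResponseP (1 / 2000) (1 / 100) (1 / 10) 8 4 12 16 16 (1 / 2) (1 / 400) 5 (3 / 400) (3 / 400) (3 / 10)
      Rφ CsG CsI CsB CIG CII CIB CBG CBI CBB 1 2 (1 / 16) (1 / 50))
    (hL : ReferenceLoadP (1 / 2000) (1 / 100) (1 / 10) 8 4 12 16 16 (1 / 2) (1 / 400) 5 (3 / 400) (3 / 400) (3 / 10)
      Rφ εg εI εb 1 2 (1 / 16) (1 / 50)) :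
    LoadedTubeAprioriP (1 / 2000) (1 / 100) (1 / 10) 8 4 12 16 16 (1 / 2) (1 / 400) 5 (3 / 400) (3 / 400) (3 / 10)
      (1 / 200) (1 / 200) (3 / 20) 1 2 (1 / 16) (1 / 50) :=
  loadedTubeAprioriP_of_response hεg hεI hεb hs hI hB hG hL

/-- ★ **THE RECORD GEOMETRY through part YO (PROVED)**: (XR) ∧ (X1)(lam = 7/2000) at `ϑ₀ = 1/400` with (G∞) ∧ (Res) ∧ the three inequalities ⇒ the
existence leaf `CoolMoatSlavedFillingP (1/2000) (1/100) (1/10) …` of the tube docket, via `loadPath_dial_instance`; other reference tamenesses `ϑ₀`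
go through `coolMoatSlavedFillingP_tubeSlot_of_loadPath` with `loadedTubeAprioriP_of_response` in the `hA` slot. [this file, g69 v2] -/
theorem response_dial_record {Rφ CsG CsI CsB CIG CII CIB CBG CBI CBB εg εI εb : ℝ}
    (hR : TubeReferenceP (1 / 2000) (1 / 100) (1 / 10) 8 4 12 16 16 (1 / 2) (1 / 400) 5 (3 / 400) (3 / 400) (3 / 10) 1 2 (1 / 16) (1 / 50))
    (hC : TubeConvexityP (1 / 2000) (1 / 100) (1 / 10) 8 4 12 16 16 (1 / 2) (1 / 400) 5 (3 / 400) (3 / 400) (3 / 10) (7 / 2000) 1 2 (1 / 16) (1 / 50))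
    (hεg : 0 ≤ εg) (hεI : 0 ≤ εI) (hεb : 0 ≤ εb) (hs : CsG * εg + CsI * εI + CsB * εb ≤ 1 / 200)
    (hI : CIG * εg + CII * εI + CIB * εb ≤ 1 / 200) (hB : CBG * εg + CBI * εI + CBB * εb ≤ 3 / 20)
    (hG : TubeResponseP (1 / 2000) (1 / 100) (1 / 10) 8 4 12 16 16 (1 / 2) (1 / 400) 5 (3 / 400) (3 / 400) (3 / 10)
      Rφ CsG CsI CsB CIG CII CIB CBG CBI CBB 1 2 (1 / 16) (1 / 50))
    (hL : ReferenceLoadP (1 / 2000) (1 / 100) (1 / 10) 8 4 12 16 16 (1 / 2) (1 / 400) 5 (3 / 400) (3 / 400) (3 / 10)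
      Rφ εg εI εb 1 2 (1 / 16) (1 / 50)) :
    CoolMoatSlavedFillingP (1 / 2000) (1 / 100) (1 / 10) 8 4 12 16 16 (1 / 2) 1 2 (1 / 16) (1 / 50) :=
  loadPath_dial_instance hR hC (loadedTubeAprioriP_record_of_response hεg hεI hεb hs hI hB hG hL)

end FluxResponse

end Summit.AtomisticToContinuum.Crystallization.Theorems.ChartedZeroExcessLayeredLatticeLiouville

end
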